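import Summits.MatrixMultiplication.OmegaCensus.VertexCountingLawShape
import Summits.MatrixMultiplication.OmegaCensus.DihedralLikeVertexCounting
import HarnessLib

/-!
# The law shapes at `|A| ≡ 1 (mod 3)` (slack `8`)

ω-census, family (b3).  Framing: lottery ticket; floor = certified bounds/negative ranges.

Companion of `VertexCountingLawShape.lean` (slack `4`, `|A| ≡ 2 (mod 3)`).  For `N ≡ 1 (mod 3)` the dihedral-like
law is `V = (8N − 8)/3`, i.e. total slack `8N − 3V = 8`.  The eight vertex constraints then force
(`mod_one_law_shape_of_vertex_bounds`, `V ≥ 33`) one of: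

* the **cube**: all three part pairs balanced, `(c,c | d,d | e,e)` (and then `N = 3cde + 1`);
* **two balanced pairs** `(d,d), (e,e)` and the third pair `(c, c+2)` with `de = 1`, or `(c, c+1)` with `de = 2`
  (up to the roles of the three sets).

The shapes with two singleton pairs, `(1,1 | 1,1 | q±1, q∓1)` and `(1,1 | 1,1 | q, q)`, are exactly those handled
by `DihedralLawModOneTwoCosets.lean` (they force a cyclic subgroup of index ≤ 2); the remaining ones — the cubes
with `cde = q` not of the form `(1,1,q)` and `(c, c+1 | 2,2 | 1,1)` — are the open part of the classification of
the groups `Dih(A)`, `|A| ≡ 1 (mod 3)`, attaining the law (census conjecture: iff `A` has a cyclic subgroup of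
index ≤ 2; `Dih(ℤ₂ × ℤ₈)` realizes `(2,3 | 2,2 | 1,1)`, kit j100621).  `mod_one_law_shape` is the same statement
for an actual TPP triple of a dihedral-like group.
-/

namespace Summit.MatrixMultiplication.OmegaCensus

open Literature.Combinatorics.Additive Finset

/-- From `x P = y P + 2` in `ℕ` with `P ≠ 0`: `P = 1 ∧ x = y + 2` or `P = 2 ∧ x = y + 1`. [folklore] -/
theorem shape_of_mul_eq_mul_add_two {x y P : ℕ} (hP : P ≠ 0) (h : x * P = y * P + 2) :
    (P = 1 ∧ x = y + 2) ∨ (P = 2 ∧ x = y + 1) := by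
  have hd : P ∣ x * P - y * P := Nat.dvd_sub (dvd_mul_left P x) (dvd_mul_left P y)
  have h1 : x * P - y * P = 2 := by omega
  rw [h1] at hd
  have hle : P ≤ 2 := Nat.le_of_dvd (by norm_num) hd
  interval_cases P
  · exact absurd rfl hP
  · left; exact ⟨rfl, by omega⟩
  · right; exact ⟨rfl, by omega⟩

/-- **The law shapes at slack `8`** (pure arithmetic). [folklore] -/
theorem mod_one_law_shape_of_vertex_bounds (N s₀ s₁ t₀ t₁ u₀ u₁ : ℕ)
    (h000 : s₁ * t₀ * u₀ + s₀ * t₁ * u₀ + s₀ * t₀ * u₁ ≤ N) (h111 : s₀ * t₁ * u₁ + s₁ * t₀ * u₁ + s₁ * t₁ * u₀ ≤ N)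
    (h100 : s₀ * t₀ * u₀ + s₁ * t₁ * u₀ + s₁ * t₀ * u₁ ≤ N) (h011 : s₁ * t₁ * u₁ + s₀ * t₀ * u₁ + s₀ * t₁ * u₀ ≤ N)
    (h010 : s₁ * t₁ * u₀ + s₀ * t₀ * u₀ + s₀ * t₁ * u₁ ≤ N) (h101 : s₀ * t₀ * u₁ + s₁ * t₁ * u₁ + s₁ * t₀ * u₀ ≤ N)
    (h001 : s₁ * t₀ * u₁ + s₀ * t₁ * u₁ + s₀ * t₀ * u₀ ≤ N) (h110 : s₀ * t₁ * u₀ + s₁ * t₀ * u₀ + s₁ * t₁ * u₁ ≤ N)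
    (hV : 33 ≤ (s₀ + s₁) * (t₀ + t₁) * (u₀ + u₁)) (hlaw : 3 * ((s₀ + s₁) * (t₀ + t₁) * (u₀ + u₁)) + 8 = 8 * N) :
    (s₀ = s₁ ∧ t₀ = t₁ ∧ u₀ = u₁) ∨
    (t₀ = t₁ ∧ u₀ = u₁ ∧ ((t₀ * u₀ = 1 ∧ (s₁ = s₀ + 2 ∨ s₀ = s₁ + 2)) ∨ (t₀ * u₀ = 2 ∧ (s₁ = s₀ + 1 ∨ s₀ = s₁ + 1)))) ∨
    (s₀ = s₁ ∧ u₀ = u₁ ∧ ((s₀ * u₀ = 1 ∧ (t₁ = t₀ + 2 ∨ t₀ = t₁ + 2)) ∨ (s₀ * u₀ = 2 ∧ (t₁ = t₀ + 1 ∨ t₀ = t₁ + 1)))) ∨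
    (s₀ = s₁ ∧ t₀ = t₁ ∧ ((s₀ * t₀ = 1 ∧ (u₁ = u₀ + 2 ∨ u₀ = u₁ + 2)) ∨ (s₀ * t₀ = 2 ∧ (u₁ = u₀ + 1 ∨ u₀ = u₁ + 1)))) := by
  have hD : 8 * N ≤ 3 * ((s₀ + s₁) * (t₀ + t₁) * (u₀ + u₁)) + 13 := by omega
  by_cases hs : s₀ = s₁ <;> by_cases ht : t₀ = t₁ <;> by_cases hu : u₀ = u₁
  · exact Or.inl ⟨hs, ht, hu⟩
  · -- `s`, `t` balanced, `u` unbalanced: `U` is the odd one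
    right; right; right
    subst hs; subst ht
    refine ⟨rfl, rfl, ?_⟩
    have k1 : u₁ * (s₀ * t₀) + 2 * (u₀ * (s₀ * t₀)) ≤ N := by linarith [h000]
    have k2 : u₀ * (s₀ * t₀) + 2 * (u₁ * (s₀ * t₀)) ≤ N := by linarith [h011]
    have k3 : 12 * (u₀ * (s₀ * t₀)) + 12 * (u₁ * (s₀ * t₀)) + 8 = 8 * N := by linarith [hlaw]
    have hP : s₀ * t₀ ≠ 0 := by
      intro h0
      have : (s₀ + s₀) * (t₀ + t₀) * (u₀ + u₁) = 4 * (s₀ * t₀) * (u₀ + u₁) := by ring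
      rw [this, h0] at hV; omega
    rcases Nat.lt_or_gt_of_ne hu with hlt | hlt
    · have hab : u₁ * (s₀ * t₀) = u₀ * (s₀ * t₀) + 2 := by
        have : u₀ * (s₀ * t₀) ≤ u₁ * (s₀ * t₀) := Nat.mul_le_mul_right _ hlt.le
        have hne' : u₀ * (s₀ * t₀) ≠ u₁ * (s₀ * t₀) := fun h =>
          hu (Nat.eq_of_mul_eq_mul_right (Nat.pos_of_ne_zero hP) h)
        omega
      rcases shape_of_mul_eq_mul_add_two hP hab with ⟨h1, h2⟩ | ⟨h1, h2⟩
      · exact Or.inl ⟨h1, Or.inl h2⟩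
      · exact Or.inr ⟨h1, Or.inl h2⟩
    · have hab : u₀ * (s₀ * t₀) = u₁ * (s₀ * t₀) + 2 := by
        have : u₁ * (s₀ * t₀) ≤ u₀ * (s₀ * t₀) := Nat.mul_le_mul_right _ hlt.le
        have hne' : u₁ * (s₀ * t₀) ≠ u₀ * (s₀ * t₀) := fun h =>
          hu (Nat.eq_of_mul_eq_mul_right (Nat.pos_of_ne_zero hP) h).symm
        omega
      rcases shape_of_mul_eq_mul_add_two hP hab with ⟨h1, h2⟩ | ⟨h1, h2⟩
      · exact Or.inl ⟨h1, Or.inr h2⟩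
      · exact Or.inr ⟨h1, Or.inr h2⟩
  · -- `s`, `u` balanced, `t` unbalanced
    right; right; left
    subst hs; subst hu
    refine ⟨rfl, rfl, ?_⟩
    have k1 : t₁ * (s₀ * u₀) + 2 * (t₀ * (s₀ * u₀)) ≤ N := by linarith [h000]
    have k2 : t₀ * (s₀ * u₀) + 2 * (t₁ * (s₀ * u₀)) ≤ N := by linarith [h010]
    have k3 : 12 * (t₀ * (s₀ * u₀)) + 12 * (t₁ * (s₀ * u₀)) + 8 = 8 * N := by linarith [hlaw]
    have hP : s₀ * u₀ ≠ 0 := by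
      intro h0
      have : (s₀ + s₀) * (t₀ + t₁) * (u₀ + u₀) = 4 * (s₀ * u₀) * (t₀ + t₁) := by ring
      rw [this, h0] at hV; omega
    rcases Nat.lt_or_gt_of_ne ht with hlt | hlt
    · have hab : t₁ * (s₀ * u₀) = t₀ * (s₀ * u₀) + 2 := by
        have : t₀ * (s₀ * u₀) ≤ t₁ * (s₀ * u₀) := Nat.mul_le_mul_right _ hlt.le
        have hne' : t₀ * (s₀ * u₀) ≠ t₁ * (s₀ * u₀) := fun h =>
          ht (Nat.eq_of_mul_eq_mul_right (Nat.pos_of_ne_zero hP) h)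
        omega
      rcases shape_of_mul_eq_mul_add_two hP hab with ⟨h1, h2⟩ | ⟨h1, h2⟩
      · exact Or.inl ⟨h1, Or.inl h2⟩
      · exact Or.inr ⟨h1, Or.inl h2⟩
    · have hab : t₀ * (s₀ * u₀) = t₁ * (s₀ * u₀) + 2 := by
        have : t₁ * (s₀ * u₀) ≤ t₀ * (s₀ * u₀) := Nat.mul_le_mul_right _ hlt.le
        have hne' : t₁ * (s₀ * u₀) ≠ t₀ * (s₀ * u₀) := fun h =>
          ht (Nat.eq_of_mul_eq_mul_right (Nat.pos_of_ne_zero hP) h).symm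
        omega
      rcases shape_of_mul_eq_mul_add_two hP hab with ⟨h1, h2⟩ | ⟨h1, h2⟩
      · exact Or.inl ⟨h1, Or.inr h2⟩
      · exact Or.inr ⟨h1, Or.inr h2⟩
  · -- `s` balanced only
    subst hs
    exact (one_balanced_false N s₀ t₀ t₁ u₀ u₁ ht hu (by linarith) (by linarith) (by linarith) (by linarith)
      hV hD).elim
  · -- `t`, `u` balanced, `s` unbalanced
    right; left
    subst ht; subst hu
    refine ⟨rfl, rfl, ?_⟩
    have k1 : s₁ * (t₀ * u₀) + 2 * (s₀ * (t₀ * u₀)) ≤ N := by linarith [h000]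
    have k2 : s₀ * (t₀ * u₀) + 2 * (s₁ * (t₀ * u₀)) ≤ N := by linarith [h100]
    have k3 : 12 * (s₀ * (t₀ * u₀)) + 12 * (s₁ * (t₀ * u₀)) + 8 = 8 * N := by linarith [hlaw]
    have hP : t₀ * u₀ ≠ 0 := by
      intro h0
      have : (s₀ + s₁) * (t₀ + t₀) * (u₀ + u₀) = 4 * (t₀ * u₀) * (s₀ + s₁) := by ring
      rw [this, h0] at hV; omega
    rcases Nat.lt_or_gt_of_ne hs with hlt | hlt
    · have hab : s₁ * (t₀ * u₀) = s₀ * (t₀ * u₀) + 2 := by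
        have : s₀ * (t₀ * u₀) ≤ s₁ * (t₀ * u₀) := Nat.mul_le_mul_right _ hlt.le
        have hne' : s₀ * (t₀ * u₀) ≠ s₁ * (t₀ * u₀) := fun h =>
          hs (Nat.eq_of_mul_eq_mul_right (Nat.pos_of_ne_zero hP) h)
        omega
      rcases shape_of_mul_eq_mul_add_two hP hab with ⟨h1, h2⟩ | ⟨h1, h2⟩
      · exact Or.inl ⟨h1, Or.inl h2⟩
      · exact Or.inr ⟨h1, Or.inl h2⟩
    · have hab : s₀ * (t₀ * u₀) = s₁ * (t₀ * u₀) + 2 := by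
        have : s₁ * (t₀ * u₀) ≤ s₀ * (t₀ * u₀) := Nat.mul_le_mul_right _ hlt.le
        have hne' : s₁ * (t₀ * u₀) ≠ s₀ * (t₀ * u₀) := fun h =>
          hs (Nat.eq_of_mul_eq_mul_right (Nat.pos_of_ne_zero hP) h).symm
        omega
      rcases shape_of_mul_eq_mul_add_two hP hab with ⟨h1, h2⟩ | ⟨h1, h2⟩
      · exact Or.inl ⟨h1, Or.inr h2⟩
      · exact Or.inr ⟨h1, Or.inr h2⟩
  · -- `t` balanced only: roles `(t, u, s)`
    subst ht
    refine (one_balanced_false N t₀ u₀ u₁ s₀ s₁ hu hs (by linarith) (by linarith) (by linarith) (by linarith)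
      ?_ ?_).elim
    · have e : (t₀ + t₀) * (u₀ + u₁) * (s₀ + s₁) = (s₀ + s₁) * (t₀ + t₀) * (u₀ + u₁) := by ring
      rw [e]; exact hV
    · have e : (t₀ + t₀) * (u₀ + u₁) * (s₀ + s₁) = (s₀ + s₁) * (t₀ + t₀) * (u₀ + u₁) := by ring
      rw [e]; exact hD
  · -- `u` balanced only: roles `(u, s, t)`
    subst hu
    refine (one_balanced_false N u₀ s₀ s₁ t₀ t₁ hs ht (by linarith) (by linarith) (by linarith) (by linarith)
      ?_ ?_).elim
    · have e : (u₀ + u₀) * (s₀ + s₁) * (t₀ + t₁) = (s₀ + s₁) * (t₀ + t₁) * (u₀ + u₀) := by ring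
      rw [e]; exact hV
    · have e : (u₀ + u₀) * (s₀ + s₁) * (t₀ + t₁) = (s₀ + s₁) * (t₀ + t₁) * (u₀ + u₀) := by ring
      rw [e]; exact hD
  · exact (unbalanced_false N s₀ s₁ t₀ t₁ u₀ u₁ hs ht hu h000 h111 h100 h011 h010 h101 h001 h110 hV hD).elim

section DihedralLike

variable {A : Type*} [AddCommGroup A] [DecidableEq A] [Fintype A] {G : Type} [Group G] [DecidableEq G]
  {ρ τ : A → G} {c₀ : A} {S T U : Finset G}

/-- **The law shapes at `|A| ≡ 1 (mod 3)` for a TPP triple of a dihedral-like group** (`|A| ≥ 14`): the coset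
part sizes form a cube or a two-balanced shape as in `mod_one_law_shape_of_vertex_bounds`. [folklore] -/
theorem mod_one_law_shape
    (hρρ : ∀ a b, ρ a * ρ b = ρ (a + b)) (hρτ : ∀ a b, ρ a * τ b = τ (b - a))
    (hτρ : ∀ a b, τ a * ρ b = τ (a + b)) (hττ : ∀ a b, τ a * τ b = ρ (c₀ + b - a))
    (hρ : Function.Injective ρ) (hτ : Function.Injective τ) (hne : ∀ a b, ρ a ≠ τ b)
    (hsurj : ∀ g, (∃ a, ρ a = g) ∨ (∃ a, τ a = g)) (hA : 14 ≤ Fintype.card A) (h : TripleProductProperty S T U)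
    (hV : 3 * (S.card * T.card * U.card) + 8 = 8 * Fintype.card A) :
    let s₀ := (univ.filter fun a : A => ρ a ∈ S).card
    let s₁ := (univ.filter fun a : A => τ a ∈ S).card
    let t₀ := (univ.filter fun a : A => ρ a ∈ T).card
    let t₁ := (univ.filter fun a : A => τ a ∈ T).card
    let u₀ := (univ.filter fun a : A => ρ a ∈ U).card
    let u₁ := (univ.filter fun a : A => τ a ∈ U).card
    (s₀ = s₁ ∧ t₀ = t₁ ∧ u₀ = u₁) ∨
    (t₀ = t₁ ∧ u₀ = u₁ ∧ ((t₀ * u₀ = 1 ∧ (s₁ = s₀ + 2 ∨ s₀ = s₁ + 2)) ∨ (t₀ * u₀ = 2 ∧ (s₁ = s₀ + 1 ∨ s₀ = s₁ + 1)))) ∨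
    (s₀ = s₁ ∧ u₀ = u₁ ∧ ((s₀ * u₀ = 1 ∧ (t₁ = t₀ + 2 ∨ t₀ = t₁ + 2)) ∨ (s₀ * u₀ = 2 ∧ (t₁ = t₀ + 1 ∨ t₀ = t₁ + 1)))) ∨
    (s₀ = s₁ ∧ t₀ = t₁ ∧ ((s₀ * t₀ = 1 ∧ (u₁ = u₀ + 2 ∨ u₀ = u₁ + 2)) ∨ (s₀ * t₀ = 2 ∧ (u₁ = u₀ + 1 ∨ u₀ = u₁ + 1)))) := by
  intro s₀ s₁ t₀ t₁ u₀ u₁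
  obtain ⟨h000, h111, h100, h011, h010, h101, h001, h110⟩ := vertex_counting' hρρ hρτ hτρ hττ hρ hτ hne h
  rw [card_eq_parts' hρ hτ hne hsurj S, card_eq_parts' hρ hτ hne hsurj T, card_eq_parts' hρ hτ hne hsurj U] at hV
  exact mod_one_law_shape_of_vertex_bounds (Fintype.card A) s₀ s₁ t₀ t₁ u₀ u₁ h000 h111 h100 h011 h010 h101 h001 h110
    (by simp only [s₀, s₁, t₀, t₁, u₀, u₁]; omega) hV

end DihedralLike

end Summit.MatrixMultiplication.OmegaCensus
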